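import Literature.AnabelianGeometry.EtaleTheta.Discharge.Sec5Thm57Kummer
import Literature.AnabelianGeometry.EtaleTheta.Discharge.Sec5Thm57Constants

/-!
# [EtTh] §5, Theorem 5.7: the Kummer-rigidity clause `hrigid` at ONE level from the COMPARISON of the transported bi-Kummer difference cocycle (pp. 329–331 / PDF pp. 103–105)

Mochizuki, *The étale theta function …*, Publ. RIMS **45** (2009)
[cite: MochizukiEtTh2009, Thm 5.7 p.330 (PDF p.104); Prop 4.3 (iii) p.317 (PDF p.91); Lem 5.8 p.331 (PDF p.105)].  Seat abc-iut-L2-d4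
(gen 5; node `EtTh:Thm5.7`, row R219/R381 «hrigid COMPOSITION»).  PROOF-ONLY over this seat's T3 (`psiAut_biKummerDiff`, p415021) and
`Sec5Thm57Constants.lean` (`kummerCocycleCap_eq_kummerCocycleCup`, p417788).

THE POINT.  `Sec5Thm57KummerRigid.lean` (p445072) reduced the anabelian residual of Thm. 5.7 to ONE clause per level: the level-`N`
unit discrepancy `w` of `Ψ` differs from a unit `ξ_N` (an `N`-th root of a fixed `ζ ∈ μ_{2l}(K)`) by a `Π_Y`-FIXED unit.  Print obtains
it by comparing Kummer classes: T3 says that `Ψ` transports the bi-Kummer difference cocycle `h ↦ s^⊓-gp_N(h)·s^⊔-gp_N(h)⁻¹` to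
`(diff ∘ θ) · κ_w ∘ θ` (the Kummer cocycle of the discrepancy appears as a FACTOR), while Prop. 5.2 (iii) [the difference cocycle IS the
mod-`N` étale theta class — abc-iut-L2-t4's R-C3], Thm. 5.6 [`Ψ^Aut` on `μ_N(B_N)` is the cyclotome transport — K4] and Cor. 2.8 (i)
[`γ^*η^Θ_N = κ_ζ·η^Θ_N·∂m` — R-C5] say that the SAME transported cocycle is `(diff ∘ θ) · κ_{ξ} ∘ θ` for a unit `ξ = ξ_N` (an `N`-th root
of `ζ` times the coboundary unit `m`).  This file proves the §5-side algebra that turns such a COMPARISON into the fixedness clause: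
* `ThetaFrobenioid.conj_eq_of_kummerCocycle_eq` — in any group, inside an abelian normal subgroup: `κ_w(c) = κ_ξ(c)` ⇒ `c·(w ξ⁻¹)·c⁻¹ = w ξ⁻¹`;
* `ThetaFrobenioid.isFixedHB_discrepancy_of_kummerComparison` — for a transport datum `(α, β, e, D_c := 1, D_p := w, θ)` (abc-iut-w5-d245's
  normalised shape) with `hT`, `hT′`, `hstrv`, `hYdd`, the §5 facts `SgpCapSpec`/`SgpCupSpec`/Prop. 4.3 (iii), and the COMPARISON
  `HC : ∀ h ∈ H_{B_N}, Ψ^Aut(diff(h)) = diff(θh) · κ_ξ(θh)`: `w·ξ⁻¹` commutes with `s^⊓-gp_N(h)` for every `h ∈ H_{B_N}`;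
* `ThetaFrobenioid.isFixed_discrepancy_of_kummerComparison` — with the factorisation `hfac` (GAP G-L2d4-1: every element of `Π_Y` acts on
  `O^×(B_N)` like some element of `H_{B_N}`), `w·ξ⁻¹` is `Π_Y`-FIXED — exactly the per-level clause of `hrigid` in `pow_two_l_eq_one_of_kummerRigid`.
So the producers of R-C3 / K4 / R-C5 have ONE joint target in §5 currency: the hypothesis `HC`.
HONEST FRAMING: kernel-checked identities between typed §5 data under named hypotheses; `HC` is NOT proved here; nothing of [EtTh] is
asserted unconditionally; typed ≠ discharged; no side taken on anything downstream ([IUTchIII] Cor. 3.12 in particular). -/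

namespace Literature.AnabelianGeometry.EtaleTheta

open CategoryTheory

universe w v v' u u'

namespace ThetaFrobenioid

variable {C : Type u} [Category.{v} C] {D : Type u'} [Category.{v'} D] {𝔉 : ThetaFrobenioid.{w} C D}

/-- **Equal Kummer cocycles ⇒ the quotient is fixed** (inside an abelian normal subgroup `U` of a group `G`): if `w, ξ ∈ U` and
`c·w·c⁻¹·w⁻¹ = c·ξ·c⁻¹·ξ⁻¹`, then `c·(w·ξ⁻¹)·c⁻¹ = w·ξ⁻¹` (Lemma 5.8 proof, p.331: elements on which the action is through the same
character).  [cite: MochizukiEtTh2009, Lem 5.8 p.331 (PDF p.105)] -/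
theorem conj_eq_of_kummerCocycle_eq {G : Type*} [Group G] (U : Subgroup G) [U.Normal] [IsMulCommutative U] {w ξ : G}
    (hw : w ∈ U) (hξ : ξ ∈ U) (c : G) (h : c * w * c⁻¹ * w⁻¹ = c * ξ * c⁻¹ * ξ⁻¹) :
    c * (w * ξ⁻¹) * c⁻¹ = w * ξ⁻¹ := by
  have hcw : c * w * c⁻¹ ∈ U := ‹U.Normal›.conj_mem w hw c
  have hcξ : c * ξ * c⁻¹ ∈ U := ‹U.Normal›.conj_mem ξ hξ c
  -- `c w c⁻¹ = (c ξ c⁻¹) ξ⁻¹ w`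
  have h1 : c * w * c⁻¹ = c * ξ * c⁻¹ * ξ⁻¹ * w := by
    rw [← h, inv_mul_cancel_right]
  have hcomm : c * ξ * c⁻¹ * ξ⁻¹ * w = w * ξ⁻¹ * (c * ξ * c⁻¹) := by
    have e1 : ξ⁻¹ * w = w * ξ⁻¹ := setLike_mul_comm (s := U) (inv_mem hξ) hw
    have e2 : c * ξ * c⁻¹ * (w * ξ⁻¹) = w * ξ⁻¹ * (c * ξ * c⁻¹) :=
      setLike_mul_comm (s := U) hcξ (mul_mem hw (inv_mem hξ))
    rw [mul_assoc (c * ξ * c⁻¹), e1, e2]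
  calc c * (w * ξ⁻¹) * c⁻¹ = (c * w * c⁻¹) * (c * ξ * c⁻¹)⁻¹ := by group
    _ = w * ξ⁻¹ * (c * ξ * c⁻¹) * (c * ξ * c⁻¹)⁻¹ := by rw [h1, hcomm]
    _ = w * ξ⁻¹ := by rw [mul_inv_cancel_right]

section Comparison

variable (Ψ : C ≌ C) (α : Ψ.functor.obj 𝔉.AN ≅ 𝔉.AN) (β : Ψ.functor.obj 𝔉.BN ≅ 𝔉.BN) (e : 𝔉.AN ≅ 𝔉.AN)
  (w ξ : Aut 𝔉.BN) (θ : Aut (𝔉.base.obj 𝔉.BN) ≃* Aut (𝔉.base.obj 𝔉.BN))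

/-- **`H_{B_N}`-fixedness of `w·ξ⁻¹` from the Kummer comparison.**  Transport datum `(α, β, e, D_c := 1, D_p := w)` of
`(s^⊓_N, s^⊔_N)` (`hT`, `hT′`), `s^trv_N` transported through `e` over `θ` (`hstrv`, Thm. 4.4 (iv)), `θ(H_{B_N}) = H_{B_N}` (`hYdd`,
Prop. 2.4), the §5 facts, `w, ξ ∈ O^×(B_N)`, and the COMPARISON `HC`: `Ψ^Aut` maps the bi-Kummer difference cocycle to
`(diff ∘ θ) · (κ_ξ ∘ θ)` — as Prop. 5.2 (iii) + Thm. 5.6 + Cor. 2.8 (i) assert for `ξ` an `N`-th root of the rigidity root of unity times a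
coboundary unit.  Then (T3: the same transported cocycle is `(diff ∘ θ) · (κ_w ∘ θ)`) `κ_w = κ_ξ` on `H_{B_N}`, so `w·ξ⁻¹` commutes with
every `s^⊓-gp_N(h)`, `h ∈ H_{B_N}`.  [cite: MochizukiEtTh2009, Thm 5.7 p.330 (PDF p.104); Prop 4.3 (iii) p.317 (PDF p.91)] -/
theorem isFixedHB_discrepancy_of_kummerComparison [Epi 𝔉.sCap] [Epi 𝔉.sCup] (hcap : 𝔉.SgpCapSpec) (hcup : 𝔉.SgpCupSpec)
    (hdiff : 𝔉.BiKummerDifferenceMem)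
    (hT : α.inv ≫ Ψ.functor.map 𝔉.sCap ≫ β.hom = e.hom ≫ 𝔉.sCap ≫ (1 : Aut 𝔉.BN).hom)
    (hT' : α.inv ≫ Ψ.functor.map 𝔉.sCup ≫ β.hom = e.hom ≫ 𝔉.sCup ≫ w.hom)
    (hstrv : ∀ g : Aut (𝔉.base.obj 𝔉.BN),
      α.inv ≫ Ψ.functor.map (𝔉.strv (𝔉.autBaseIsoAB.symm g)).hom ≫ α.hom ≫ e.hom =
        e.hom ≫ (𝔉.strv (𝔉.autBaseIsoAB.symm (θ g))).hom)
    (hYdd : 𝔉.HB.map θ.toMonoidHom = 𝔉.HB) (hw : w ∈ 𝔉.units 𝔉.BN) (hξ : ξ ∈ 𝔉.units 𝔉.BN)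
    (HC : ∀ h : 𝔉.HB,
      𝔉.psiAut Ψ β (𝔉.sgpCap (h : Aut (𝔉.base.obj 𝔉.BN)) * (𝔉.sgpCup h)⁻¹) =
        (𝔉.sgpCap (θ h) * (𝔉.sgpCup ⟨θ h, (mem_iff_of_map_equiv_eq hYdd _).mpr h.2⟩)⁻¹) *
          (𝔉.sgpCup ⟨θ h, (mem_iff_of_map_equiv_eq hYdd _).mpr h.2⟩ * ξ *
            (𝔉.sgpCup ⟨θ h, (mem_iff_of_map_equiv_eq hYdd _).mpr h.2⟩)⁻¹ * ξ⁻¹)) :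
    ∀ h : 𝔉.HB, 𝔉.sgpCap (h : Aut (𝔉.base.obj 𝔉.BN)) * (w * ξ⁻¹) * (𝔉.sgpCap (h : Aut (𝔉.base.obj 𝔉.BN)))⁻¹ = w * ξ⁻¹ := by
  haveI := 𝔉.units_normal 𝔉.BN
  haveI : IsMulCommutative (𝔉.units 𝔉.BN) := 𝔉.units_comm 𝔉.BN
  -- Step 1 (T3 vs HC): `κ_w(θh) = κ_ξ(θh)` through `s^⊔-gp_N`, for every `h ∈ H_{B_N}`
  have hκ : ∀ h : 𝔉.HB,
      𝔉.sgpCup ⟨θ h, (mem_iff_of_map_equiv_eq hYdd _).mpr h.2⟩ * w *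
          (𝔉.sgpCup ⟨θ h, (mem_iff_of_map_equiv_eq hYdd _).mpr h.2⟩)⁻¹ * w⁻¹ =
        𝔉.sgpCup ⟨θ h, (mem_iff_of_map_equiv_eq hYdd _).mpr h.2⟩ * ξ *
          (𝔉.sgpCup ⟨θ h, (mem_iff_of_map_equiv_eq hYdd _).mpr h.2⟩)⁻¹ * ξ⁻¹ := by
    intro h
    have hT3 := (HC h).symm.trans (psiAut_biKummerDiff Ψ α β e 1 w θ hcap hcup hT hT' hstrv hYdd h)
    simp only [inv_one, one_mul, mul_one] at hT3
    exact (mul_left_cancel hT3).symm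
  -- Step 2: hence `w ξ⁻¹` commutes with `s^⊔-gp_N(h′)` for every `h′ ∈ H_{B_N}` (`θ` is onto `H_{B_N}`)
  have hcup' : ∀ h' : 𝔉.HB, 𝔉.sgpCup h' * (w * ξ⁻¹) * (𝔉.sgpCup h')⁻¹ = w * ξ⁻¹ := by
    intro h'
    have hmem : θ.symm (h' : Aut (𝔉.base.obj 𝔉.BN)) ∈ 𝔉.HB := by
      have := mem_iff_of_map_equiv_eq hYdd (θ.symm (h' : Aut (𝔉.base.obj 𝔉.BN)))
      rw [MulEquiv.apply_symm_apply] at this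
      exact this.mp h'.2
    obtain ⟨h, hh⟩ : ∃ h : 𝔉.HB, (⟨θ h, (mem_iff_of_map_equiv_eq hYdd _).mpr h.2⟩ : 𝔉.HB) = h' :=
      ⟨⟨θ.symm (h' : Aut (𝔉.base.obj 𝔉.BN)), hmem⟩, Subtype.ext (MulEquiv.apply_symm_apply θ _)⟩
    subst hh
    exact conj_eq_of_kummerCocycle_eq (𝔉.units 𝔉.BN) hw hξ (𝔉.sgpCup _) (hκ h)
  -- Step 3: conjugation by `s^⊓-gp_N(h)` agrees with conjugation by `s^⊔-gp_N(h)` on units (Prop. 4.3 (iii): they differ by `μ_N(B_N)`)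
  intro h
  have hu : w * ξ⁻¹ ∈ 𝔉.units 𝔉.BN := mul_mem hw (inv_mem hξ)
  have hcc := kummerCocycleCap_eq_kummerCocycleCup (𝔉 := 𝔉) hdiff hu h
  rw [hcup' h, mul_inv_cancel] at hcc
  exact mul_inv_eq_one.mp hcc

/-- **`Π_Y`-fixedness of `w·ξ⁻¹` from the Kummer comparison** — the per-level clause of `hrigid`
(`Sec5Thm57KummerRigid.pow_two_l_eq_one_of_kummerRigid`): as `isFixedHB_discrepancy_of_kummerComparison`, plus the factorisation
`hfac` (every element of `Π_Y` acts on `O^×(B_N)` through `s^⊓-gp_N` like some element of `H_{B_N}` — GAP G-L2d4-1, Lemma 5.8's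
"`Π^tp_Y` [i.e., `G_K`, via the natural surjection `Π^tp_Y ↠ G_K`]").  [cite: MochizukiEtTh2009, Thm 5.7 p.330 (PDF p.104); Lem 5.8 p.331 (PDF p.105)] -/
theorem isFixed_discrepancy_of_kummerComparison [Epi 𝔉.sCap] [Epi 𝔉.sCup] (hcap : 𝔉.SgpCapSpec) (hcup : 𝔉.SgpCupSpec)
    (hdiff : 𝔉.BiKummerDifferenceMem)
    (hfac : ∀ y ∈ 𝔉.imPiY, ∃ x ∈ 𝔉.HB, ∀ u ∈ 𝔉.units 𝔉.BN,
      𝔉.sgpCap y * u * (𝔉.sgpCap y)⁻¹ = 𝔉.sgpCap x * u * (𝔉.sgpCap x)⁻¹)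
    (hT : α.inv ≫ Ψ.functor.map 𝔉.sCap ≫ β.hom = e.hom ≫ 𝔉.sCap ≫ (1 : Aut 𝔉.BN).hom)
    (hT' : α.inv ≫ Ψ.functor.map 𝔉.sCup ≫ β.hom = e.hom ≫ 𝔉.sCup ≫ w.hom)
    (hstrv : ∀ g : Aut (𝔉.base.obj 𝔉.BN),
      α.inv ≫ Ψ.functor.map (𝔉.strv (𝔉.autBaseIsoAB.symm g)).hom ≫ α.hom ≫ e.hom =
        e.hom ≫ (𝔉.strv (𝔉.autBaseIsoAB.symm (θ g))).hom)
    (hYdd : 𝔉.HB.map θ.toMonoidHom = 𝔉.HB) (hw : w ∈ 𝔉.units 𝔉.BN) (hξ : ξ ∈ 𝔉.units 𝔉.BN)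
    (HC : ∀ h : 𝔉.HB,
      𝔉.psiAut Ψ β (𝔉.sgpCap (h : Aut (𝔉.base.obj 𝔉.BN)) * (𝔉.sgpCup h)⁻¹) =
        (𝔉.sgpCap (θ h) * (𝔉.sgpCup ⟨θ h, (mem_iff_of_map_equiv_eq hYdd _).mpr h.2⟩)⁻¹) *
          (𝔉.sgpCup ⟨θ h, (mem_iff_of_map_equiv_eq hYdd _).mpr h.2⟩ * ξ *
            (𝔉.sgpCup ⟨θ h, (mem_iff_of_map_equiv_eq hYdd _).mpr h.2⟩)⁻¹ * ξ⁻¹)) :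
    ∀ y ∈ 𝔉.imPiY, 𝔉.sgpCap y * (w * ξ⁻¹) * (𝔉.sgpCap y)⁻¹ = w * ξ⁻¹ := by
  intro y hy
  obtain ⟨x, hx, hxy⟩ := hfac y hy
  rw [hxy _ (mul_mem hw (inv_mem hξ))]
  exact isFixedHB_discrepancy_of_kummerComparison Ψ α β e w ξ θ hcap hcup hdiff hT hT' hstrv hYdd hw hξ HC ⟨x, hx⟩

end Comparison

end ThetaFrobenioid

end Literature.AnabelianGeometry.EtaleTheta
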